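import Mathlib
import Literature.Barriers.PneNP.CorrelationPolytopeXCLowerBoundGraph
import Literature.Barriers.PneNP.ExtendedFormulationLinearImage
import Summits.ValiantsHypothesis.ValiantsHypothesis.Theorems.FifoMatchingNNDivisionHardLowDimExposure
import HarnessLib

/-!
# The FLAG LEMMA and the ★ DIMENSION RUNG for `COR(n) + Q` (val-idea-40's `DimensionRung.lean` §4; class D of line
# `virtual_passenger`, crux `Theses.FifoMatching.NNDivisionHard`, stmt-ValiantsHypothesis-21181)

Theorems-side port (port hand val-port-1 g3; desk RULING #331 «LowDim PORT»; `--supports stmt-ValiantsHypothesis-21181 --as helper`) of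
`Cruxes/NNDivisionHard/DimensionRung.lean` (rev 4 @a45b7939cb12, val-idea-40 g0, sha16 e492007789666bf5; critic of record val-idea-crit-9 g0)
§4, proof texts VERBATIM over `…LowDimDefs` (`faceKer`, `psi`, `ent`) and `…LowDimExposure` (the EXPOSURE RUNG).

CONTENT: `faceKer_prop` (what the face equations of `F_{A,∅}` say entrywise), ★ FLAG LEMMA `faceKer_flag` (a vector annihilated by the
face equations of `F_{A ∪ {j}, ∅}` for EVERY `j ∉ A` is zero), `faceKer_mono`, `faceKer_univ`, `faceKer_flagStep`, `faceKer_flag_iterate`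
(`dim (V ⊓ K_A)` more prescribed indices kill `V ⊓ K`), `three_two_descend`, and ★★ **DIMENSION RUNG** `corPolytope_add_three_pow_le_of_finrank`
/ `corPolytopeGraph_top_add_hull_three_pow_le_of_finrank`: for EVERY finite generating family `q` — no genericity, no vertex count, no sign
pattern — an extended formulation of `COR(K_h) + conv{q j}` of size `r` forces `3^{h−d} ≤ (r+1)·2^{h−d}`, `d = dim aff {q j}`; i.e.
`xc(COR(K_h) + Q) ≥ 1.5^{h − dim Q} − 1` (COR-MINKOWSKI holds for every passenger of dimension `≤ (1−ε)h`).  This is the theorem the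
line's class D (`DimDeficient`, `dimDeficient_three_halves_pow_le`) cites; the δ-wire into `Lines/virtual_passenger.lean` /
`DimensionRung.lean` is the 21181 line pen's (desk #331 (d)).

HONEST FRAMING: a certificate for a class of passengers (restriction of COR-MINKOWSKI / COR-VIRTUAL); the SURVIVORS are the passengers
whose direction space needs `≥ (1−ε)h` flag indices (fan-saturating zonotopes, dense towers); stmt-21181 `NNDivisionHard` OPEN;
`VP ≠ VNP` NOT proved; nothing here is a summit statement.
-/

set_option autoImplicit false

-- the mandated summit-side namespace repeats a component by design (single-problem summit)
set_option linter.dupNamespace false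

noncomputable section

open Matrix Finset
open scoped Pointwise

namespace Summit.ValiantsHypothesis.ValiantsHypothesis.Theorems.FifoMatching

namespace LowDim

open Literature.Barriers.PneNP (HasEFOfSize)
open Literature.Combinatorics.Optimization (corPolytopeGraph)
open Literature.Combinatorics.Optimization.FixedSizePsdRank (Cube vecOuter bvec corPolytope flat
  flat_dotProduct_vecOuter)
open Summit.ValiantsHypothesis.ValiantsHypothesis.Theorems.FifoMatching.XcDivision

variable {n : ℕ}

/-! ## §4 The FLAG LEMMA and the DIMENSION RUNG (unconditional; DimensionRung §4 verbatim — `faceKer` is in the Defs file) -/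

/-- membership in the solution space of the face equations, unfolded. -/
theorem mem_faceKer {A : Finset (Fin n)} {x : Fin (n * n) → ℝ} :
    x ∈ faceKer A ↔ ∀ t, psi A ∅ t ⬝ᵥ x = 0 := Iff.rfl

/-- what the face equations say entrywise: zero on `A × A`, and row `p ∈ A` coupled to the diagonal off `A`. -/
theorem faceKer_prop {A : Finset (Fin n)} {x : Fin (n * n) → ℝ} (hx : x ∈ faceKer A) :
    (∀ p ∈ A, ∀ q ∈ A, x (finProdFinEquiv (p, q)) = 0) ∧
    (∀ p ∈ A, ∀ k ∉ A, x (finProdFinEquiv (p, k)) = x (finProdFinEquiv (k, k))) := by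
  rw [mem_faceKer] at hx
  constructor
  · intro p hp q hq
    have h1 := hx (false, p, q)
    have hcond : p ∈ A ∪ ∅ ∧ q ∈ A ∪ ∅ := by simp [hp, hq]
    simp only [psi] at h1
    rw [if_pos hcond, ent_dot] at h1
    exact h1
  · intro p hp k hk
    have h1 := hx (true, p, k)
    have hk' : k ∉ A ∪ ∅ := by simpa using hk
    simp only [psi] at h1
    rw [if_neg hk', if_pos hp, sub_dotProduct, ent_dot, ent_dot] at h1
    linarith

/-- ★ **FLAG LEMMA (PROVED):** a vector annihilated by the face equations of `F_{A ∪ {j}, ∅}` for EVERY `j ∉ A`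
(`A ≠ univ`) is zero — so inside any nonzero direction space some one-index extension of the flag cuts the kernel. -/
theorem faceKer_flag {A : Finset (Fin n)} {x : Fin (n * n) → ℝ} (hA : A ≠ Finset.univ)
    (hx : ∀ j ∉ A, x ∈ faceKer (insert j A)) : x = 0 := by
  classical
  obtain ⟨j₀, hj₀⟩ : ∃ j, j ∉ A := by
    by_contra hcon
    push Not at hcon
    exact hA (Finset.eq_univ_of_forall hcon)
  funext i
  obtain ⟨⟨p, q⟩, rfl⟩ := finProdFinEquiv.surjective i
  show x (finProdFinEquiv (p, q)) = 0
  by_cases hp : p ∈ A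
  · by_cases hq : q ∈ A
    · exact (faceKer_prop (hx j₀ hj₀)).1 p (Finset.mem_insert_of_mem hp) q (Finset.mem_insert_of_mem hq)
    · exact (faceKer_prop (hx q hq)).1 p (Finset.mem_insert_of_mem hp) q (Finset.mem_insert_self q A)
  · by_cases hq : q ∈ A
    · exact (faceKer_prop (hx p hp)).1 p (Finset.mem_insert_self p A) q (Finset.mem_insert_of_mem hq)
    · by_cases hpq : p = q
      · subst hpq
        exact (faceKer_prop (hx p hp)).1 p (Finset.mem_insert_self p A) p (Finset.mem_insert_self p A)
      · have h1 := (faceKer_prop (hx p hp)).2 p (Finset.mem_insert_self p A) q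
          (by rw [Finset.mem_insert]; push Not; exact ⟨fun h => hpq h.symm, hq⟩)
        have h2 := (faceKer_prop (hx q hq)).1 q (Finset.mem_insert_self q A) q
          (Finset.mem_insert_self q A)
        rw [h1, h2]

/-- bigger flags have smaller solution spaces. -/
theorem faceKer_mono {A A' : Finset (Fin n)} (hAA' : A ⊆ A') : faceKer A' ≤ faceKer A := by
  intro x hx
  have hP := faceKer_prop hx
  rw [mem_faceKer]
  intro t
  obtain ⟨c, p, q⟩ := t
  cases c
  · simp only [psi]
    split_ifs with h
    · rw [ent_dot]
      simp only [Finset.union_empty] at h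
      exact hP.1 p (hAA' h.1) q (hAA' h.2)
    · simp
  · simp only [psi]
    split_ifs with hk hp hp'
    · simp
    · rw [sub_dotProduct, ent_dot, ent_dot]
      simp only [Finset.union_empty] at hk
      by_cases hkA' : q ∈ A'
      · rw [hP.1 p (hAA' hp) q hkA', hP.1 q hkA' q hkA', sub_zero]
      · rw [hP.2 p (hAA' hp) q hkA', sub_self]
    · simp at hp'
    · simp

/-- the full flag kills everything. -/
theorem faceKer_univ : faceKer (Finset.univ : Finset (Fin n)) = ⊥ := by
  rw [Submodule.eq_bot_iff]
  intro x hx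
  funext i
  obtain ⟨⟨p, q⟩, rfl⟩ := finProdFinEquiv.surjective i
  exact (faceKer_prop hx).1 p (Finset.mem_univ p) q (Finset.mem_univ q)

/-- the flag, one step: a nonzero subspace leaves the solution space of some one-index extension. -/
theorem faceKer_flagStep {A : Finset (Fin n)} (V : Submodule ℝ (Fin (n * n) → ℝ))
    (hA : A ≠ Finset.univ) (hV : V ≠ ⊥) : ∃ j ∉ A, ¬ (V ≤ faceKer (insert j A)) := by
  by_contra hcon
  push Not at hcon
  apply hV
  rw [Submodule.eq_bot_iff]
  intro x hx
  exact faceKer_flag hA (fun j hj => hcon j hj hx)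

/-- the flag, iterated: `dim (V ⊓ K_A)` more prescribed indices kill `V ⊓ K`. -/
theorem faceKer_flag_iterate (V : Submodule ℝ (Fin (n * n) → ℝ)) :
    ∀ (k : ℕ) (A : Finset (Fin n)), Module.finrank ℝ ↥(V ⊓ faceKer A) ≤ k →
      ∃ A' : Finset (Fin n), A'.card ≤ A.card + k ∧ V ⊓ faceKer A' = ⊥ := by
  intro k
  induction k with
  | zero =>
    intro A hA
    exact ⟨A, by simp, Submodule.finrank_eq_zero.1 (Nat.le_zero.1 hA)⟩
  | succ k ih =>
    intro A hA
    by_cases hbot : V ⊓ faceKer A = ⊥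
    · exact ⟨A, by simp, hbot⟩
    · have hAu : A ≠ Finset.univ := by
        rintro rfl
        exact hbot (by rw [faceKer_univ]; simp)
      obtain ⟨j, hj, hnot⟩ := faceKer_flagStep (V ⊓ faceKer A) hAu hbot
      have hle : V ⊓ faceKer (insert j A) ≤ V ⊓ faceKer A :=
        inf_le_inf_left _ (faceKer_mono (Finset.subset_insert j A))
      have hlt : V ⊓ faceKer (insert j A) < V ⊓ faceKer A := by
        refine lt_of_le_of_ne hle ?_
        intro heq
        apply hnot
        rw [← heq]
        exact inf_le_right
      have hrank := Submodule.finrank_lt_finrank_of_lt hlt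
      obtain ⟨A', hcard, hA'⟩ := ih (insert j A) (by omega)
      refine ⟨A', ?_, hA'⟩
      have := Finset.card_insert_le j A
      omega

/-- `3^{m'} ≤ R·2^{m'}` descends to every `m ≤ m'`. -/
theorem three_two_descend {m m' R : ℕ} (hmm : m ≤ m') (H : 3 ^ m' ≤ R * 2 ^ m') :
    3 ^ m ≤ R * 2 ^ m := by
  obtain ⟨k, rfl⟩ := Nat.exists_eq_add_of_le hmm
  have h2 : 0 < 2 ^ k := by positivity
  have key : 3 ^ m * 2 ^ k ≤ R * 2 ^ m * 2 ^ k :=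
    calc 3 ^ m * 2 ^ k ≤ 3 ^ m * 3 ^ k :=
          Nat.mul_le_mul_left _ (Nat.pow_le_pow_left (by norm_num) k)
      _ = 3 ^ (m + k) := (pow_add 3 m k).symm
      _ ≤ R * 2 ^ (m + k) := H
      _ = R * 2 ^ m * 2 ^ k := by rw [pow_add, mul_assoc]
  exact Nat.le_of_mul_le_mul_right key h2

/-- ★★ **DIMENSION RUNG (PROVED, unconditional, Q-uniform):** for EVERY finite generating family `q` —
no genericity, no vertex count, no sign pattern — an extended formulation of `COR(n) + conv{q j}` of size `r` forces
`3^{n-d} ≤ (r+1)·2^{n-d}`, `d = dim (aff {q j})`; i.e. `xc(COR(n) + Q) ≥ 1.5^{n - dim Q} - 1`.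
(`d = 0`: FMPTW/Kaibel–Weltge; `d < (1-ε)n`: still `2^{Ω(n)}`; the SURVIVORS of the lens are exactly the passengers
whose direction space needs `≥ (1-ε)n` flag indices to be cut — fan-saturating zonotopes `Z_h`, dense towers.) -/
theorem corPolytope_add_three_pow_le_of_finrank {n r : ℕ} {J : Type} [Fintype J] [Nonempty J] [DecidableEq J]
    (q : J → (Fin (n * n) → ℝ))
    (h : HasEFOfSize (corPolytope n + convexHull ℝ (Set.range q)) r) :
    3 ^ (n - Module.finrank ℝ ↥(vectorSpan ℝ (Set.range q))) ≤
      (r + 1) * 2 ^ (n - Module.finrank ℝ ↥(vectorSpan ℝ (Set.range q))) := by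
  classical
  obtain ⟨A', hcard, hA'⟩ := faceKer_flag_iterate (vectorSpan ℝ (Set.range q))
    (Module.finrank ℝ ↥(vectorSpan ℝ (Set.range q))) ∅ (Submodule.finrank_mono inf_le_left)
  have hsep : ∀ j j', (∀ t, psi A' ∅ t ⬝ᵥ (q j - q j') = 0) → q j = q j' := by
    intro j j' ht
    have hK : q j - q j' ∈ faceKer A' := ht
    have hV : q j - q j' ∈ vectorSpan ℝ (Set.range q) := by
      have := vsub_mem_vectorSpan ℝ (Set.mem_range_self (f := q) j) (Set.mem_range_self (f := q) j')
      rwa [vsub_eq_sub] at this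
    have hmem' : q j - q j' ∈ vectorSpan ℝ (Set.range q) ⊓ faceKer A' := ⟨hV, hK⟩
    rw [hA', Submodule.mem_bot] at hmem'
    exact sub_eq_zero.1 hmem'
  have hR : (A'ᶜ).card = n - A'.card := by rw [Finset.card_compl, Fintype.card_fin]
  let e : Fin (n - A'.card) ↪ Fin n := ((A'ᶜ).orderEmbOfFin hR).toEmbedding
  have he : ∀ i, e i ∉ A' := fun i => Finset.mem_compl.1 (Finset.orderEmbOfFin_mem _ hR i)
  have hrung := corPolytope_add_genericFace_three_pow_le h q
    (fun j => subset_convexHull ℝ _ (Set.mem_range_self j)) subset_rfl A' ∅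
    (Finset.disjoint_empty_right A') e he (fun i => by simp) hsep
  simp only [Finset.card_empty, zero_add] at hcard
  exact three_two_descend (by omega) hrung


/-- ★★ **DIMENSION RUNG in the route's graph currency `COR(K_h) = corPolytopeGraph ⊤`** (the currency of
`CorMinkowskiHard`, of AFHMS's located clique face and of `transport_geometric`): for every finite family `q`,
`3^{h-d} ≤ (r+1)·2^{h-d}` with `d = dim (aff {q j})`.  With `J = Fin (K+1)` this is literally `CorMinkowskiHard`'s
hypothesis ⇒ `r + 1 ≥ 1.5^{h - dim Q}`: COR-MINKOWSKI holds for every passenger of dimension `≤ (1-ε)h`. -/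
theorem corPolytopeGraph_top_add_hull_three_pow_le_of_finrank {h r : ℕ} {J : Type} [Fintype J] [Nonempty J]
    [DecidableEq J] (q : J → (Fin h × Fin h → ℝ))
    (hyp : HasEFOfSize (corPolytopeGraph (⊤ : SimpleGraph (Fin h)) + convexHull ℝ (Set.range q)) r) :
    3 ^ (h - Module.finrank ℝ ↥(vectorSpan ℝ (Set.range q))) ≤
      (r + 1) * 2 ^ (h - Module.finrank ℝ ↥(vectorSpan ℝ (Set.range q))) := by
  let e : (Fin h × Fin h → ℝ) ≃ₗ[ℝ] (Fin (h * h) → ℝ) :=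
    LinearEquiv.funCongrLeft ℝ ℝ (finProdFinEquiv (m := h) (n := h)).symm
  have himg : e '' (corPolytopeGraph (⊤ : SimpleGraph (Fin h)) + convexHull ℝ (Set.range q)) =
      corPolytope h + convexHull ℝ (Set.range (e ∘ q)) := by
    rw [Set.image_add, Literature.Barriers.PneNP.corPolytope_eq_image_corPolytopeGraph_top, Set.range_comp]
    congr 1
    exact e.toLinearMap.image_convexHull (Set.range q)
  have h' : HasEFOfSize (corPolytope h + convexHull ℝ (Set.range (e ∘ q))) r := by
    rw [← himg]; exact (HasEFOfSize.image_linearEquiv_iff e).2 hyp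
  have hdim : Module.finrank ℝ ↥(vectorSpan ℝ (Set.range (e ∘ q))) =
      Module.finrank ℝ ↥(vectorSpan ℝ (Set.range q)) := by
    rw [Set.range_comp]
    have hvs : vectorSpan ℝ (e '' Set.range q) =
        (vectorSpan ℝ (Set.range q)).map (e : (Fin h × Fin h → ℝ) →ₗ[ℝ] (Fin (h * h) → ℝ)) := by
      have := AffineMap.map_vectorSpan (e.toLinearMap.toAffineMap) (s := Set.range q)
      simpa using this.symm
    rw [hvs]
    exact LinearEquiv.finrank_map_eq e _
  have := corPolytope_add_three_pow_le_of_finrank (e ∘ q) h'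
  rwa [hdim] at this

end LowDim

end Summit.ValiantsHypothesis.ValiantsHypothesis.Theorems.FifoMatching

end
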